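import Summits.CriticalPhenomena.SAWScalingLimit.Theorems.SAWLeftRightFKGFKGToTraversalBoundSlitNecklacePieces
import HarnessLib

/-!
# Window transfer for strictly separated index windows
(crux `SAWLeftRightFKG.FKGToTraversalBound`, stmt-CriticalPhenomena-1878; line `slit-necklace`,
plumbing helper of the registered stub `stub_necklaceAssembly`)

The index windows of a walk `p` inside an index range `[n, n']` are exactly the index windows of the
window sub-walk `q = p[n, n']` (as produced by
`ExcursionDomination.ShellIteration.exists_subwalk_window`: `q.length = n' - n`,
`q.getVert m = p.getVert (n + min m (n' - n))`) inside its whole range `[0, q.length]`, by the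
index shift `a ↦ a - n` / `a' ↦ n + a'`.  Pure bookkeeping; no literature fact.
-/

noncomputable section

open Metric

namespace Summit.CriticalPhenomena.SAWScalingLimit.Theorems.FKGToTraversalBound.SlitNecklace

/-- **Window transfer.**  Let `q` be the window sub-walk of `p` on the index range `[n, n']`
(`n ≤ n' ≤ p.length`, `q.length = n' - n`, `q.getVert m = p.getVert (n + min m (n' - n))`).  Then
`k` strictly separated index windows of `p` inside `[n, n']` across the shell `D(y; σ₁, σ₂)` are the
same thing as `k` strictly separated index windows of `q` inside `[0, q.length]` across that shell
(shift the windows by `n`). [folklore] -/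
theorem hasSepWindows_window_iff : ∀ {V E : Type*} [PseudoMetricSpace E] {G : SimpleGraph V}
    {u v : V} (emb : V → E) (p : G.Walk u v) (n n' : ℕ) (q : G.Walk (p.getVert n) (p.getVert n')),
    n ≤ n' → n' ≤ p.length → q.length = n' - n →
    (∀ m, q.getVert m = p.getVert (n + min m (n' - n))) → ∀ (k : ℕ) (y : E) (σ₁ σ₂ : ℝ),
    HasSepWindows emb p k n n' y σ₁ σ₂ ↔ HasSepWindows emb q k 0 q.length y σ₁ σ₂ := by
  intro V E _ G u v emb p n n' q hnn' _hn' hlen hget k y σ₁ σ₂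
  constructor
  · rintro ⟨a, b, hab, hside, hsep⟩
    -- the shifted index `i - n` of `q` is the index `i` of `p`
    have hget' : ∀ i, n ≤ i → i ≤ n' → q.getVert (i - n) = p.getVert i := fun i h1 h2 => by
      rw [hget]
      congr 1
      omega
    refine ⟨fun m => a m - n, fun m => b m - n, fun m => ?_, fun m => ?_, fun m m' hmm' => ?_⟩
    · show 0 ≤ a m - n ∧ a m - n ≤ b m - n ∧ b m - n ≤ q.length
      have h := hab m
      omega
    · show (dist (emb (q.getVert (a m - n))) y ≤ σ₁ ∧ σ₂ ≤ dist (emb (q.getVert (b m - n))) y) ∨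
        (σ₂ ≤ dist (emb (q.getVert (a m - n))) y ∧ dist (emb (q.getVert (b m - n))) y ≤ σ₁)
      have h := hab m
      rw [hget' (a m) h.1 (h.2.1.trans h.2.2), hget' (b m) (h.1.trans h.2.1) h.2.2]
      exact hside m
    · show b m - n < a m' - n
      have h := hab m
      have h' := hsep hmm'
      omega
  · rintro ⟨a, b, hab, hside, hsep⟩
    -- the index `i` of `q` is the shifted index `n + i` of `p`
    have hget' : ∀ i, i ≤ q.length → q.getVert i = p.getVert (n + i) := fun i hi => by
      rw [hget]
      congr 1
      omega
    refine ⟨fun m => n + a m, fun m => n + b m, fun m => ?_, fun m => ?_, fun m m' hmm' => ?_⟩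
    · show n ≤ n + a m ∧ n + a m ≤ n + b m ∧ n + b m ≤ n'
      have h := hab m
      omega
    · show (dist (emb (p.getVert (n + a m))) y ≤ σ₁ ∧ σ₂ ≤ dist (emb (p.getVert (n + b m))) y) ∨
        (σ₂ ≤ dist (emb (p.getVert (n + a m))) y ∧ dist (emb (p.getVert (n + b m))) y ≤ σ₁)
      have h := hab m
      rw [← hget' (a m) (h.2.1.trans h.2.2), ← hget' (b m) h.2.2]
      exact hside m
    · show n + b m < n + a m'
      have h' := hsep hmm'
      omega

end Summit.CriticalPhenomena.SAWScalingLimit.Theorems.FKGToTraversalBound.SlitNecklace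

end
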